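import Literature.NumberTheory.LFunctions.KloostermanPrimePowerTools
import Literature.NumberTheory.LFunctions.IncompleteKloostermanSmooth
import HarnessLib

/-!
# Averaging a Kloosterman sum over a unit twist gives a product of Ramanujan sums

Supports stmt-Parity-20343 (`BeyondDiagonalBeatsQuarter`, K_B; line A `prime-averaged-squeeze`):
the algebraic identity behind «an average over PRIME LEVELS turns the ε-side Kloosterman terms of the
Petersson formula into Ramanujan sums» — what the landau-siegel rescue bed D130-3 supplement v4
(«mechanism by closed forms», rescue/ls-rescue-bed-6/RESULTS.md §4) measured as the part of the
fixed-level remainder that SURVIVES a dyadic prime average. A helper; it closes nothing.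
For `q ≥ 1` and `a, b ∈ ℤ/qℤ`,
`∑_{w ∈ (ℤ/qℤ)ˣ} S(a, w b; q) = S(a, 0; q) · S(0, b; q) = c_q(a) · c_q(b)`
(orthogonality: `∑_w e(w b x̄/q) = c_q(b x̄) = c_q(b)` for every unit `x̄`). This is the
elementary identity behind «an average over the level turns the Kloosterman sums of the
Petersson formula into Ramanujan sums»: for a prime level `p ∤ r` one has
`S(p m, n; p r) = −S(m, p̄ n; r)` (twisted multiplicativity), and averaging `p̄` over the reduced
classes mod `r` leaves `−c_r(m) c_r(n)/φ(r)`. Everything here is PROVED (theorems only) from the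
tree's `kloostermanSum` (`KloostermanPrimePower.lean`), its unit-group form and symmetry
(`KloostermanPrimePowerTools.lean`) and `kloostermanSum_zero_left_eq_ramanujanSum`
(`IncompleteKloostermanSmooth.lean`).

## Contents
* `kloostermanSum_mul_unit_zero` — `S(c u, 0; q) = S(c, 0; q)` for a unit `u`
  (a Ramanujan sum only sees its argument up to units);
* `sum_units_kloostermanSum_mul` — `∑_{w ∈ (ℤ/qℤ)ˣ} S(a, w b; q) = S(a, 0; q) · S(0, b; q)`;
* `sum_units_kloostermanSum_mul_eq_ramanujanSum` — `= c_q(a) · c_q(b)`;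
* `sum_units_kloostermanSum_mul_left` — the same with the twist on the first argument.

## References
* [folklore] Orthogonality of additive characters on `(ℤ/qℤ)ˣ`; cf. H. Iwaniec, *Spectral Methods of
  Automorphic Forms* (2002), §2.5 (2.23) (Kloosterman sums) and (2.26) (`S(m, 0; c)` is the Ramanujan sum
  `Σ_{δ ∣ (c,m)} μ(c/δ) δ`, so it depends on `m` only through `(c, m)`).
«The programme SEARCHES and TYPES; no claim about Landau–Siegel zeros, Theorems 1–2 of
arXiv:2211.02515 or a repaired Margin232 until a kernel theorem says so.»
-/

noncomputable section

open Finset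

namespace Summit.Parity.GeneralizedHardyLittlewood.Theorems

open Literature.NumberTheory.LFunctions

variable {q : ℕ} [NeZero q]

/-- `S(c u, 0; q) = S(c, 0; q)` for a unit `u` of `ℤ/qℤ`: the substitution `v ↦ u v` on
`(ℤ/qℤ)ˣ` (a Ramanujan sum depends on its argument only up to units). [folklore] -/
theorem kloostermanSum_mul_unit_zero (c : ZMod q) (u : (ZMod q)ˣ) :
    kloostermanSum q (c * u) 0 = kloostermanSum q c 0 := by
  rw [kloostermanSum_eq_sum_units, kloostermanSum_eq_sum_units]
  simp only [zero_mul, add_zero]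
  refine Fintype.sum_equiv (Equiv.mulLeft u) _ _ fun v => ?_
  simp only [Equiv.coe_mulLeft, Units.val_mul, mul_assoc]

/-- **Unit average of a Kloosterman sum.** `∑_{w ∈ (ℤ/qℤ)ˣ} S(a, w b; q) = S(a, 0; q) · S(0, b; q)`:
write `S(a, w b; q) = ∑_{v} e(a v/q) e(w b v̄/q)`, exchange the sums, and use
`∑_{w} e(w (b v̄)/q) = S(b v̄, 0; q) = S(b, 0; q)` (`v̄` a unit). [folklore] -/
theorem sum_units_kloostermanSum_mul (a b : ZMod q) :
    ∑ w : (ZMod q)ˣ, kloostermanSum q a ((w : ZMod q) * b) =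
      kloostermanSum q a 0 * kloostermanSum q 0 b := by
  have hinner : ∀ v : (ZMod q)ˣ,
      ∑ w : (ZMod q)ˣ, (ZMod.stdAddChar ((w : ZMod q) * b * ((v⁻¹ : (ZMod q)ˣ) : ZMod q)) : ℂ) =
        kloostermanSum q b 0 := by
    intro v
    rw [← kloostermanSum_mul_unit_zero b v⁻¹, kloostermanSum_eq_sum_units]
    refine Fintype.sum_congr _ _ fun w => ?_
    rw [zero_mul, add_zero]
    congr 1
    ring
  calc ∑ w : (ZMod q)ˣ, kloostermanSum q a ((w : ZMod q) * b)
      = ∑ w : (ZMod q)ˣ, ∑ v : (ZMod q)ˣ, (ZMod.stdAddChar (a * (v : ZMod q)) : ℂ) *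
          (ZMod.stdAddChar ((w : ZMod q) * b * ((v⁻¹ : (ZMod q)ˣ) : ZMod q)) : ℂ) := by
        refine Fintype.sum_congr _ _ fun w => ?_
        rw [kloostermanSum_eq_sum_units]
        refine Fintype.sum_congr _ _ fun v => ?_
        rw [← AddChar.map_add_eq_mul]
    _ = ∑ v : (ZMod q)ˣ, (ZMod.stdAddChar (a * (v : ZMod q)) : ℂ) *
          ∑ w : (ZMod q)ˣ, (ZMod.stdAddChar ((w : ZMod q) * b * ((v⁻¹ : (ZMod q)ˣ) : ZMod q)) : ℂ) := by
        rw [Finset.sum_comm]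
        refine Fintype.sum_congr _ _ fun v => ?_
        rw [Finset.mul_sum]
    _ = ∑ v : (ZMod q)ˣ, (ZMod.stdAddChar (a * (v : ZMod q)) : ℂ) * kloostermanSum q b 0 := by
        refine Fintype.sum_congr _ _ fun v => ?_
        rw [hinner v]
    _ = kloostermanSum q a 0 * kloostermanSum q 0 b := by
        rw [← Finset.sum_mul, kloostermanSum_comm (0 : ZMod q) b, kloostermanSum_eq_sum_units a 0]
        congr 1
        refine Fintype.sum_congr _ _ fun v => ?_
        rw [zero_mul, add_zero]

/-- `∑_{w ∈ (ℤ/qℤ)ˣ} S(a, w b; q) = c_q(a) · c_q(b)` (Ramanujan sums). [folklore] -/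
theorem sum_units_kloostermanSum_mul_eq_ramanujanSum (a b : ZMod q) :
    ∑ w : (ZMod q)ˣ, kloostermanSum q a ((w : ZMod q) * b) =
      Literature.NumberTheory.Sieve.ramanujanSum q (a.val : ℤ) *
        Literature.NumberTheory.Sieve.ramanujanSum q (b.val : ℤ) := by
  rw [sum_units_kloostermanSum_mul, kloostermanSum_comm a 0,
    MatomakiMerikoski.kloostermanSum_zero_left_eq_ramanujanSum,
    MatomakiMerikoski.kloostermanSum_zero_left_eq_ramanujanSum]

/-- The same average with the unit twist on the first argument:
`∑_{w ∈ (ℤ/qℤ)ˣ} S(w a, b; q) = c_q(a) · c_q(b)`. [folklore] -/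
theorem sum_units_kloostermanSum_mul_left (a b : ZMod q) :
    ∑ w : (ZMod q)ˣ, kloostermanSum q ((w : ZMod q) * a) b =
      Literature.NumberTheory.Sieve.ramanujanSum q (a.val : ℤ) *
        Literature.NumberTheory.Sieve.ramanujanSum q (b.val : ℤ) := by
  rw [mul_comm (Literature.NumberTheory.Sieve.ramanujanSum q _)]
  rw [← sum_units_kloostermanSum_mul_eq_ramanujanSum b a]
  exact Fintype.sum_congr _ _ fun w => kloostermanSum_comm _ _

end Summit.Parity.GeneralizedHardyLittlewood.Theorems
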